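import Summits.SmoothPoincare4.SmoothPoincare4.Theses.InformationMetricHadamard
import Summits.SmoothPoincare4.SmoothPoincare4.Theses.EinsteinBulk
import Summits.SmoothPoincare4.SmoothPoincare4.Theorems.InformationMetricHadamardAhHadamardFillingUcstReduction
import Literature.Geometry.Riemannian.AHCompleteness
import Literature.Geometry.Lorentzian.LeviCivitaCurvature

/-!
# Crux `InformationMetricHadamard.AhHadamardFilling` (item stmt-SmoothPoincare4-6014) — the ROUTE-LEVEL
# SPLIT: `AhHadamardFilling ⇐ YamabeExtremalSpheres ∧ PEFillNearRound ∧ YamabePinchedEinsteinBulk ∧ CompactificationCollar`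

Crux-strategist r1 (RESTATED re-exam, BC2 redirect). The crux is kernel-equivalent to the summit
(`Negative/IffSmoothPoincare4`, p127185), so it counts as an honest reduction only through a typed
decomposition whose assembly is PROVED. This file is that assembly, sorry-free, with the four pieces
as hypotheses:

* `X₁ = EinsteinBulk.YamabeExtremalSpheres` (item stmt-SmoothPoincare4-7998, open conjecture, SHARED with
  route `EinsteinBulk`);
* `X₂ = EinsteinBulk.PEFillNearRound` (item 7997, open conjecture, SHARED);
* `X₃ = EinsteinBulk.YamabePinchedEinsteinBulk` (item 7996, the Li–Qing–Shi 2017 Thm 1.8 named fact, SHARED;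
  vendored as `Literature.Geometry.Riemannian.liQingShi_pinching_five` + `.inlined`);
* `X₄ = CompactificationCollar` (NEW item of this route; the true collar lemma of the live line
  `einstein-bulk-transfer`, lead c7's φ-free statement, INLINED verbatim as the fourth hypothesis — no `def : Prop` is introduced
  under Summits/ and this file does not depend on the sorried skeleton
  `Cruxes/AhHadamardFilling/Lines/einstein_bulk_transfer.lean`).

`ahHadamardFilling_of_pieces : X₁ → X₂ → X₃ → X₄ → AhHadamardFilling` lands on the proved reduction
`UniversalCoverStripsTopology.ahHadamardFilling_of_connectedCollarFillings` (p124840: closure clause,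
completeness and simple connectivity of a connected `sec ≤ 0` collar filling are automatic) and NOT on
`SmoothPoincare4`; between the pieces sits real mathematics (the two thresholds `δ₂ = δ_LQS(1/2)`,
`δ₃ = δ_PE`, Yamabe-extremality at `min δ₂ δ₃`, pinching `|K+1| ≤ 1/2 ⇒ K ≤ 0`, the curvature-format
bridge from `Rm ≤ 0` on orthonormal pairs for the tree's Levi-Civita connection to
`sectionalCurvature cov ≤ 0` for EVERY Levi-Civita `cov`, and the constant rescaling `κ₀ g₀` of the
boundary metric). The mathematics is the strategist-p1 / lead-c7 composition of the line card
`Lines/einstein-bulk-transfer.md`; it is re-homed here (namespace `…Theorems.AhHadamardFillingSplit`,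
disjoint from the lead's `…EinsteinBulkTransfer`) so that the gate can use it as the `--glue-by`
theorem of `route edit --split AhHadamardFilling`.
-/

noncomputable section

-- the prescribed namespace `Summit.<P>.<Sub>.…` duplicates `SmoothPoincare4` (P = Sub)
set_option linter.dupNamespace false

open scoped Manifold ContDiff Topology ENNReal NNReal ContinuousMap
open Set Function Bundle
open Literature.Topology.FourManifolds Literature.Geometry.Lorentzian Literature.Geometry.Riemannian
open Summit.SmoothPoincare4.SmoothPoincare4.Theses

namespace Summit.SmoothPoincare4.SmoothPoincare4.Theorems.AhHadamardFillingSplit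

/-! ## The curvature-format bridge (PROVED, strategist p1): Einstein-bulk form ⇒ crux form -/

/-- Cauchy–Schwarz for a Riemannian pseudo-Riemannian metric: `g(X,Y)² ≤ g(X,X)·g(Y,Y)`, i.e. the
denominator of `sectionalCurvature` is nonnegative. [folklore] -/
theorem val_sq_le_val_mul_val (B : Type) [TopologicalSpace B] [T2Space B] [SecondCountableTopology B]
    [ChartedSpace (EuclideanSpace ℝ (Fin 5)) B] [IsManifold (𝓡 5) ∞ B]
    (G : PseudoRiemannianMetric (𝓡 5) ∞ (EuclideanSpace ℝ (Fin 5)) (TangentSpace (𝓡 5) : B → Type _))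
    (hG : G.IsRiemannian) (x : B) (X Y : TangentSpace (𝓡 5) x) :
    G.val x X Y ^ 2 ≤ G.val x X X * G.val x Y Y := by
  have hnn : ∀ w : TangentSpace (𝓡 5) x, 0 ≤ G.val x w w := by
    intro w
    by_cases hw : w = 0
    · subst hw; simp
    · exact (hG x w hw).le
  by_cases hY : Y = 0
  · subst hY; simp
  have hYY : 0 < G.val x Y Y := hG x Y hY
  set a : ℝ := G.val x X X with ha
  set b : ℝ := G.val x X Y with hb
  set d : ℝ := G.val x Y Y with hd
  -- expand `0 ≤ g(dX - bY, dX - bY) = d (a d - b²)`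
  have hexp : G.val x (d • X - b • Y) (d • X - b • Y) = d * (a * d - b ^ 2) := by
    have hYX : G.val x Y X = b := by rw [hb, G.symm x X Y]
    simp only [map_sub, map_smul, FunLike.coe_sub, Pi.sub_apply, FunLike.coe_smul, Pi.smul_apply,
      smul_eq_mul, hYX, ← ha, ← hb, ← hd]
    ring
  have h0 : 0 ≤ d * (a * d - b ^ 2) := hexp ▸ hnn _
  have h1 : 0 ≤ a * d - b ^ 2 := by
    by_contra h
    rw [not_le] at h
    have : d * (a * d - b ^ 2) < 0 := mul_neg_of_pos_of_neg hYY h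
    linarith
  linarith

/-- **Curvature-format bridge.** For the pseudo-Riemannian metric `G = ofRiemannian g` of a smooth
Riemannian 5-manifold: if `Rm(X,Y,Y,X) ≤ 0` on `G`-orthonormal pairs for the tree's Levi-Civita
connection `G.leviCivita`, then `sectionalCurvature cov x X Y ≤ 0` for EVERY Levi-Civita connection
`cov` of `G` and all pairs `X, Y` (the crux's curvature clause). Uniqueness of the Levi-Civita
curvature (`IsLeviCivita.curvature_eq_riemann`), Gram–Schmidt
(`SimpleAH.curvatureForm_leviCivita_nonpos_of_orthonormal`) and Cauchy–Schwarz for the denominator.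
[cite: ONeill1983, Ch. 3, Thm. 3.11 and Def. 3.39] -/
theorem sectionalCurvature_nonpos_of_orthonormal_leviCivita
    (N : Type) [TopologicalSpace N] [T2Space N] [SecondCountableTopology N]
    [ChartedSpace (EuclideanSpace ℝ (Fin 5)) N] [IsManifold (𝓡 5) ∞ N]
    (g : Bundle.ContMDiffRiemannianMetric (𝓡 5) ∞ (EuclideanSpace ℝ (Fin 5))
      (TangentSpace (𝓡 5) : N → Type _))
    [(PseudoRiemannianMetric.ofRiemannian g).HasLeviCivita]
    (hK : ∀ (x : N) (X Y : TangentSpace (𝓡 5) x), g.inner x X X = 1 → g.inner x Y Y = 1 →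
      g.inner x X Y = 0 →
      (PseudoRiemannianMetric.ofRiemannian g).curvatureForm
        (PseudoRiemannianMetric.ofRiemannian g).leviCivita x X Y Y X ≤ 0) :
    ∀ cov, (PseudoRiemannianMetric.ofRiemannian g).IsLeviCivita cov →
      ∀ (x : N) (X Y : TangentSpace (𝓡 5) x),
        (PseudoRiemannianMetric.ofRiemannian g).sectionalCurvature cov x X Y ≤ 0 := by
  intro cov hcov x X Y
  have hG : (PseudoRiemannianMetric.ofRiemannian g).IsRiemannian :=
    PseudoRiemannianMetric.isRiemannian_ofRiemannian g
  have h2 : (2 : ℕ∞ω) ≤ (∞ : ℕ∞ω) := WithTop.coe_le_coe.2 le_top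
  -- the numerator for the tree's Levi-Civita connection, on all pairs
  have hLC : (PseudoRiemannianMetric.ofRiemannian g).curvatureForm
      (PseudoRiemannianMetric.ofRiemannian g).leviCivita x X Y Y X ≤ 0 :=
    SimpleAH.curvatureForm_leviCivita_nonpos_of_orthonormal h2 hG hK x X Y
  -- the numerator for `cov` equals the one for `leviCivita`
  have hnum : (PseudoRiemannianMetric.ofRiemannian g).curvatureForm cov x X Y Y X ≤ 0 := by
    unfold PseudoRiemannianMetric.curvatureForm at hLC ⊢
    rw [hcov.curvature_eq_riemann h2 x]
    exact hLC
  -- the denominator is nonnegative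
  have hden : 0 ≤ (PseudoRiemannianMetric.ofRiemannian g).val x X X *
      (PseudoRiemannianMetric.ofRiemannian g).val x Y Y -
      (PseudoRiemannianMetric.ofRiemannian g).val x X Y ^ 2 :=
    sub_nonneg.2 (val_sq_le_val_mul_val N _ hG x X Y)
  unfold PseudoRiemannianMetric.sectionalCurvature
  exact div_nonpos_of_nonpos_of_nonneg hnum hden

/-! ## A constant rescaling of a pseudo-Riemannian metric (for `κ₀ g₀`) -/

/-- The constant multiple `κ • g` of a pseudo-Riemannian metric (`κ ≠ 0`): still symmetric,
nondegenerate and `C^n`. [folklore] -/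
def scaledMetric {B : Type} [TopologicalSpace B] [ChartedSpace (EuclideanSpace ℝ (Fin 4)) B]
    [IsManifold (𝓡 4) ∞ B] (κ : ℝ) (hκ : κ ≠ 0)
    (g : PseudoRiemannianMetric (𝓡 4) ∞ (EuclideanSpace ℝ (Fin 4)) (TangentSpace (𝓡 4) : B → Type _)) :
    PseudoRiemannianMetric (𝓡 4) ∞ (EuclideanSpace ℝ (Fin 4)) (TangentSpace (𝓡 4) : B → Type _) where
  val b := κ • g.val b
  symm b v w := by
    simp only [FunLike.coe_smul, Pi.smul_apply, smul_eq_mul, g.symm b v w]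
  nondegenerate b v hv := g.nondegenerate b v fun w => by
    have h := hv w
    simp only [FunLike.coe_smul, Pi.smul_apply, smul_eq_mul, mul_eq_zero] at h
    exact h.resolve_left hκ
  contMDiff := by
    set_option synthInstance.maxHeartbeats 200000 in
    exact g.contMDiff.const_smul_section (a := κ)

/-- The value of the rescaled metric. [folklore] -/
@[simp] theorem scaledMetric_val_apply {B : Type} [TopologicalSpace B]
    [ChartedSpace (EuclideanSpace ℝ (Fin 4)) B] [IsManifold (𝓡 4) ∞ B] (κ : ℝ) (hκ : κ ≠ 0)
    (g : PseudoRiemannianMetric (𝓡 4) ∞ (EuclideanSpace ℝ (Fin 4)) (TangentSpace (𝓡 4) : B → Type _))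
    (b : B) (v w : TangentSpace (𝓡 4) b) :
    (scaledMetric κ hκ g).val b v w = κ * g.val b v w := by
  simp only [scaledMetric, FunLike.coe_smul, Pi.smul_apply, smul_eq_mul]

/-- A positive constant multiple of a Riemannian metric is Riemannian. [folklore] -/
theorem isRiemannian_scaledMetric {B : Type} [TopologicalSpace B]
    [ChartedSpace (EuclideanSpace ℝ (Fin 4)) B] [IsManifold (𝓡 4) ∞ B] {κ : ℝ} (hκ : 0 < κ)
    (g : PseudoRiemannianMetric (𝓡 4) ∞ (EuclideanSpace ℝ (Fin 4)) (TangentSpace (𝓡 4) : B → Type _))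
    (hg : g.IsRiemannian) : (scaledMetric κ hκ.ne' g).IsRiemannian := fun b v hv => by
  rw [scaledMetric_val_apply]
  exact mul_pos hκ (hg b v hv)

/-! ## The composition: the three sibling items + the collar statement ⇒ the crux BY NAME -/

/-- **THE SPLIT ASSEMBLY (BC2 redirect of the RESTATED crux): the crux BY NAME from the four pieces**
`YamabeExtremalSpheres → PEFillNearRound → YamabePinchedEinsteinBulk → CompactificationCollar →
AhHadamardFilling`, landing on `ahHadamardFilling_of_connectedCollarFillings` (p124840), NOT on
`SmoothPoincare4`. The fourth hypothesis is piece X₄, the **compactification collar** (lead c7's φ-free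
statement of line `einstein-bulk-transfer`, inlined verbatim; it becomes the route item
`InformationMetricHadamard.CompactificationCollar` at the split): let `(N⁵, g)` carry the `C²`
conformal-compactification package of route `EinsteinBulk` over the closed 4-manifold `M` with boundary
class `[g₀]` (compact connected `X̄` with boundary, `j : N ≅ int X̄`, `ι : M ≅ ∂X̄`, smooth bdf `ρ` with
`|dρ|_ḡ = 1` on `∂X̄`, a `C²` metric `ḡ` with `j^*ḡ = ρ² g` and `ι^*ḡ = φ·g₀`); then `N` is connected and
there are `c > 0`, `κ₀ > 0` and an end collar `Φ : M × (0,1) → N` — smooth, injective, with co-compact far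
parts — on which `g` is `C⁰`-conical over `κ₀ g₀`. For a homotopy 4-sphere `Σ`: Li–Qing–Shi at `ε = 1/2`
gives `δ₂`, PE-FILL gives `δ₃`; Yamabe-extremality at `η = min δ₂ δ₃` gives `g₀`; PE-FILL fills `(Σ,[g₀])`
by a `C²`-conformally compact Einstein `(N, g)`; Li–Qing–Shi pinches it, so `Rm ≤ 0` on orthonormal pairs,
hence (bridge) `sec ≤ 0` for every Levi-Civita connection; the collar statement gives the crux's collar
over `(Σ, κ₀ g₀)`; p124840 supplies completeness, the closure clause and simple connectivity. -/
theorem ahHadamardFilling_of_pieces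
    (hY : EinsteinBulk.YamabeExtremalSpheres)
    (hP : EinsteinBulk.PEFillNearRound)
    (hL : EinsteinBulk.YamabePinchedEinsteinBulk)
    (hT : -- piece X₄ `CompactificationCollar` (lead c7, verbatim statement)
      ∀ (M : Type) [TopologicalSpace M] [T2Space M] [SecondCountableTopology M]
      [ChartedSpace (EuclideanSpace ℝ (Fin 4)) M] [IsManifold (𝓡 4) ∞ M] [CompactSpace M]
      (g₀ : Bundle.ContMDiffRiemannianMetric (𝓡 4) ∞ (EuclideanSpace ℝ (Fin 4))
        (TangentSpace (𝓡 4) : M → Type _))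
      (N : Type) [TopologicalSpace N] [T2Space N] [SecondCountableTopology N]
      [ChartedSpace (EuclideanSpace ℝ (Fin 5)) N] [IsManifold (𝓡 5) ∞ N]
      (g : Bundle.ContMDiffRiemannianMetric (𝓡 5) ∞ (EuclideanSpace ℝ (Fin 5))
        (TangentSpace (𝓡 5) : N → Type _)),
      (∃ (X : Type) (_ : TopologicalSpace X) (_ : T2Space X) (_ : SecondCountableTopology X)
        (_ : ChartedSpace (EuclideanHalfSpace 5) X) (_ : IsManifold (𝓡∂ 5) ∞ X) (_ : CompactSpace X)
        (_ : ConnectedSpace X) (j : N → X) (ι : M → X) (ρ : X → ℝ)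
        (gb : Bundle.ContMDiffRiemannianMetric (𝓡∂ 5) 2 (EuclideanSpace ℝ (Fin 5))
          (TangentSpace (𝓡∂ 5) : X → Type _)),
        Manifold.IsSmoothEmbedding (𝓡 5) (𝓡∂ 5) ∞ j ∧ Set.range j = (𝓡∂ 5).interior X ∧
        Manifold.IsSmoothEmbedding (𝓡 4) (𝓡∂ 5) ∞ ι ∧ Set.range ι = (𝓡∂ 5).boundary X ∧
        ContMDiff (𝓡∂ 5) 𝓘(ℝ, ℝ) ∞ ρ ∧ (∀ x : X, 0 ≤ ρ x) ∧
        (∀ x : X, ρ x = 0 ↔ x ∈ (𝓡∂ 5).boundary X) ∧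
        (∀ y : M, ∃ ν : TangentSpace (𝓡∂ 5) (ι y), gb.inner (ι y) ν ν = 1 ∧
          ∀ v : TangentSpace (𝓡∂ 5) (ι y), gb.inner (ι y) ν v = mfderiv (𝓡∂ 5) 𝓘(ℝ, ℝ) ρ (ι y) v) ∧
        (∀ (x : N) (v w : TangentSpace (𝓡 5) x),
          gb.inner (j x) (mfderiv (𝓡 5) (𝓡∂ 5) j x v) (mfderiv (𝓡 5) (𝓡∂ 5) j x w) =
            ρ (j x) ^ 2 * g.inner x v w) ∧
        (∃ φ : M → ℝ, ∀ y : M, 0 < φ y ∧ ∀ v w : TangentSpace (𝓡 4) y,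
          gb.inner (ι y) (mfderiv (𝓡 4) (𝓡∂ 5) ι y v) (mfderiv (𝓡 4) (𝓡∂ 5) ι y w) =
            φ y * g₀.inner y v w)) →
      ConnectedSpace N ∧
      ∃ (c κ₀ : ℝ) (Φ : M × ℝ → N), 0 < c ∧ 0 < κ₀ ∧
        ContMDiffOn ((𝓡 4).prod 𝓘(ℝ, ℝ)) (𝓡 5) ∞ Φ (univ ×ˢ Ioo (0 : ℝ) 1) ∧
        InjOn Φ (univ ×ˢ Ioo (0 : ℝ) 1) ∧
        (∀ t ∈ Ioo (0 : ℝ) 1, IsCompact (Φ '' (univ ×ˢ Ioo (0 : ℝ) t))ᶜ) ∧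
        (∀ ε : ℝ, 0 < ε → ∃ t ∈ Ioo (0 : ℝ) 1, ∀ (x : M) (l : ℝ), l ∈ Ioo (0 : ℝ) t →
          ∀ (v : TangentSpace (𝓡 4) x) (s : ℝ),
            |g.inner (Φ (x, l))
                  (mfderiv ((𝓡 4).prod 𝓘(ℝ, ℝ)) (𝓡 5) Φ (x, l) (v, s))
                  (mfderiv ((𝓡 4).prod 𝓘(ℝ, ℝ)) (𝓡 5) Φ (x, l) (v, s)) -
                c * (s ^ 2 + κ₀ * g₀.inner x v v) / l ^ 2|
              ≤ ε * (c * (s ^ 2 + κ₀ * g₀.inner x v v) / l ^ 2))) :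
    Summit.SmoothPoincare4.SmoothPoincare4.Theses.InformationMetricHadamard.AhHadamardFilling := by
  refine Cruxes.AhHadamardFilling.UniversalCoverStripsTopology.ahHadamardFilling_of_connectedCollarFillings ?_
  intro S
  -- the homotopy equivalence and the instances demanded by the Einstein-bulk items
  obtain ⟨he⟩ := S.nonempty_homotopyEquiv
  haveI : PathConnectedSpace (Metric.sphere (0 : EuclideanSpace ℝ (Fin 5)) 1) := by
    rw [← isPathConnected_iff_pathConnectedSpace]
    refine isPathConnected_sphere ?_ 0 zero_le_one
    rw [← Module.finrank_eq_rank, finrank_euclideanSpace_fin]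
    norm_num
  haveI : PathConnectedSpace S.carrier := by
    have e : (Metric.sphere (0 : EuclideanSpace ℝ (Fin 5)) 1) ≃ₕ S.carrier := he.symm
    have key : ∀ y : S.carrier, Joined (e.toFun (e.invFun y)) y := fun y =>
      ⟨e.right_inv.some.evalAt y⟩
    refine ⟨⟨e.toFun (Classical.arbitrary _)⟩, fun y y' => ?_⟩
    have hmid : Joined (e.toFun (e.invFun y)) (e.toFun (e.invFun y')) :=
      ⟨(PathConnectedSpace.somePath (e.invFun y) (e.invFun y')).map e.toFun.continuous⟩
    exact ((key y).symm.trans hmid).trans (key y')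
  letI : MeasurableSpace S.carrier := borel S.carrier
  haveI : BorelSpace S.carrier := ⟨rfl⟩
  -- the two thresholds: Li–Qing–Shi pinching at `ε = 1/2`, and the PE-filling threshold
  obtain ⟨δ₂, hδ₂, H2⟩ := hL (1 / 2) (by norm_num)
  obtain ⟨δ₃, hδ₃, H3⟩ := hP
  -- Yamabe-extremality at `η = min δ₂ δ₃` gives the near-round class `[g₀]`
  obtain ⟨g₀, hYg⟩ := hY S.carrier he (min δ₂ δ₃) (lt_min hδ₂ hδ₃)
  have mono : ∀ {δ C V I : ℝ}, min δ₂ δ₃ ≤ δ → 0 ≤ C → 0 ≤ V →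
      (1 - min δ₂ δ₃) * C * V ≤ I → (1 - δ) * C * V ≤ I := by
    intro δ C V I hδ hC hV h
    exact (mul_le_mul_of_nonneg_right
      (mul_le_mul_of_nonneg_right (sub_le_sub_left hδ 1) hC) hV).trans h
  -- the Poincaré–Einstein filling of `(Σ, [g₀])`
  obtain ⟨N, _, _, _, _, _, g, _, hRic, hpack⟩ := H3 S.carrier he g₀ (by
    intro h' _ hconf
    exact mono (min_le_right _ _) (by positivity) (Real.sqrt_nonneg _) (hYg h' hconf))
  -- pinching `|Rm + 1| ≤ 1/2` on the bulk, hence `Rm ≤ 0` on orthonormal pairs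
  have hpinch := H2 S.carrier g₀ N g hRic hpack (by
    intro h' _ hconf
    exact mono (min_le_left _ _) (by positivity) (Real.sqrt_nonneg _) (hYg h' hconf))
  have hK : ∀ (x : N) (X Y : TangentSpace (𝓡 5) x), g.inner x X X = 1 → g.inner x Y Y = 1 →
      g.inner x X Y = 0 →
      (PseudoRiemannianMetric.ofRiemannian g).curvatureForm
        (PseudoRiemannianMetric.ofRiemannian g).leviCivita x X Y Y X ≤ 0 := by
    intro x X Y hX1 hY1 hXY0
    have h := abs_le.mp (hpinch x X Y hX1 hY1 hXY0)
    linarith [h.2]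
  -- the curvature clause of the crux, for every Levi-Civita connection
  have hsec := sectionalCurvature_nonpos_of_orthonormal_leviCivita N g hK
  -- the compactification collar, C⁰-conical over `κ₀ g₀`
  obtain ⟨hconn, c, κ₀, Φ, hc, hκ₀, hsm, hinj, hco, hasym⟩ := hT S.carrier g₀ N g hpack
  haveI : ConnectedSpace N := hconn
  refine ⟨scaledMetric κ₀ hκ₀.ne' (PseudoRiemannianMetric.ofRiemannian g₀),
    isRiemannian_scaledMetric hκ₀ _ (PseudoRiemannianMetric.isRiemannian_ofRiemannian g₀),
    N, inferInstance, inferInstance, inferInstance, inferInstance, inferInstance, hconn,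
    PseudoRiemannianMetric.ofRiemannian g, PseudoRiemannianMetric.isRiemannian_ofRiemannian g,
    c, Φ, hc, hsec, hsm, hinj, hco, ?_⟩
  simpa only [scaledMetric_val_apply, PseudoRiemannianMetric.val_ofRiemannian] using hasym

end Summit.SmoothPoincare4.SmoothPoincare4.Theorems.AhHadamardFillingSplit

end
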